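/-
Copyright (c) 2026 the pub-hodgecm-mathlib formalisation cell (harness21).  Prover seat hodgecm-mathlib-LH4-p11 (g2), req620 Track A «(D-RAM) FOUR-FRAME» squad
(unit U3_Laws, (R-17) «NI2 ⊕ MS», MS ROAD A Stage A; brick (O2c) «THE ORBIT COUNT» — THE HEAD: Stage A `Σ_e C_tv(e) = 8·N_tv` in `𝓛₀(T)`-weight currency;
MS first-seat lineage LH4-p11 (g0) `MS-ROAD-A-BRICKS.v2` (O) = (O1) + (O2a) + (O2b) + (O2c); acting MS first seat LH4-p10 (g2) MS LEDGER v4; dealer LH4-plan (g11)).  2026-09-04.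
-/
import Summits.HodgeConjecture.HodgeConjecture.Theorems.F0P3cDyRamDiagonalOrbitAveraging         -- (O2c) FILE 1 (this seat): the generic engine `sum_ncard_fixed_vertices_eq_eight_mul_finsum_stabiliserWeight_of_fibre_identity`; brings ★ (O1), ★ (O2a)
import Summits.HodgeConjecture.HodgeConjecture.Theorems.F0P3cDyRamDiagonalOrbitFibreCountHeads  -- ★ (O2b) PART 4 (LH4-p14 (g2)): `finsum_ncard_fibre_mul_relIndex_eq_of_mem_normalisedStableLattices{,_zero}`; brings PARTS 1–3
import Summits.HodgeConjecture.HodgeConjecture.Theorems.F0P3cDyRamDiagonalOrbitFibreCountMultHeads   -- ★ (O2b)-MULT M3 p856421 (LH4-p14 (g2)): `finsum_ncard_fibre_mul_relIndex_eq_mul_ncard_cosets_of_mem_normalisedStableLattices` (ED. 2)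
import Summits.HodgeConjecture.HodgeConjecture.Theorems.F0P3cDyRamDiagonalStrataDefs                 -- ★ p855793 + ED. 2 p856137 + ED. 3 (LH4-p11): `IsTypeTwoPolarisable`, `polarisationCount` (ED. 2)
import HarnessLib

/-!
# Crux `H413`, line LH4 «(D-RAM) FOUR-FRAME» road — unit U3_Laws (iii), MS ROAD A Stage A, brick (O2c): THE ORBIT COUNT — THE HEAD
# `Σ_{e ∈ (ℤ∕2)³} #{M : M a type-tv vertex of diag(c^{e}), T·M = M} = 8 · Σᶠ_{M₀ ∈ 𝓛₀(T), polarisable_tv} 1∕[𝒰 : S_F(M₀)]`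

Cell `hodgecm-mathlib` (D-0151), FLOOR 0, crux item H413 = `stmt-HodgeConjecture-24833`, route of record `HCCMUnconditional`; squad F0∕P3c∕LH4 (req618∕req620); registered stub served:
`F0P3cDyRamFourFrameU3.stub_U3_stableModelSum` (MS; tree `Cruxes/H413/Lines/F0_P3c_DyRamFourFrame_U3_Laws.lean` :109).  THEOREMS ONLY (no `def`, no instance, no notation,
no `sorry`, default heartbeats); lane `--supports stmt-HodgeConjecture-24833 --as helper` (count-neutral).

THE MATHEMATICS (LH4-p10 MEMO-stableLaw-finite v1 §2 (3), v2 §0: «`Σ_s C_tv(s) = 8·N_tv` is MEMO v1 step (3) = p11's bricks K–O»).  STAGE A of the (MS) count, both vertex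
types: the left-hand side of MS :109 — the number of `T`-fixed type-`tv` vertex lattices of the eight diagonal forms `diag(c^{e})`, `e ∈ (ℤ∕2)³`, `c` a `σ`-fixed non-norm
unit with the index-two dichotomy, summed over `e` — equals `8 · N_tv`, `N_tv := Σᶠ_{M₀ ∈ 𝓛₀(T), M₀ polarisable of type tv} stabiliserWeight σ M₀`, where `𝓛₀(T)` is the finite
set of normalised `T`-stable lattices, «polarisable of type `tv`» means `M₀` is a type-`tv` vertex lattice of SOME non-degenerate `σ`-fixed diagonal form (at `tv = 0`: ★
`IsDualisableLattice σ ϖ M₀`), and `stabiliserWeight σ M₀ = 1∕[𝒰 : S_F(M₀)]`.  Assembly of ★ (O2a) (re-index the fixed vertices as pairs `(M₀, b)` over `𝓛₀(T)`), ★ (O2b)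
(LH4-p14 (g2): along the unit-torus orbit of `M₀` the pairs number `8·[𝒯 : S̃(M₀)]∕[𝒰 : S_F(M₀)]` if `M₀` is polarisable and `0` otherwise — at `tv = 0` unconditionally, at
general `tv` under the one-coset hypothesis `hcoset` = LH4-p10 (g2)'s B9-0, delivered stratum-wise by the type-2 twins) and (O2c) FILE 1 (averaging over the orbits of `𝓛₀(T)`,
`#(𝒯·M₀) = [𝒯 : S̃(M₀)]` by ★ (O1)).  Stage B (B10∕B10₂: `N_tv = [k]_q`, `2k = n₁ + n₂ + n₃ + 2 − d`) then pays `stub_U3_stableModelSum` by a U3 composition over ★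
`WildQuadraticDatum.exists_fixed_unit_not_norm_of_v_two_lt_one` (the MS binder `c` is a non-norm as soon as one fixed non-norm unit exists).

WHAT IS PROVED (`N = 3`, `[Finite 𝓀[K]]`, `T = diag(s)` with `s` pairwise-distinct units, `σ` an involution with `v ∘ σ = v`, uniformiser `ϖ` = `↑ϖu`, `c` a `σ`-fixed
non-norm unit with the dichotomy `∀ x ≠ 0 fixed, x ∈ N ∨ c·x ∈ N`).
* `sum_ncard_fixed_vertices_eq_eight_mul_finsum_stabiliserWeight` — any `tv`, under `hcoset` at every `M₀ ∈ 𝓛₀(T)` (B9-0 shape VERBATIM):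
  `↑(Σ_e #{M : type-tv for diag(c^{e}), T·M = M}) = 8 · Σᶠ_{M₀ ∈ {M ∈ 𝓛₀(T) | ∃ D σ-fixed non-degenerate, M type-tv for diag D}} stabiliserWeight σ M₀` — the B10₂ input currency.
* `sum_ncard_fixed_vertices_eq_eight_mul_finsum_stabiliserWeight_zero` — `tv = 0`, UNCONDITIONAL:
  `↑(Σ_e #{M : type-0 for diag(c^{e}), T·M = M}) = 8 · Σᶠ_{M₀ ∈ {M ∈ 𝓛₀(T) | IsDualisableLattice σ ϖ M}} stabiliserWeight σ M₀` — the B10 input currency VERBATIM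
  (★ LH4-p10 (g2) skeleton c61f53438acbd4dd `finsum_stabiliserWeight_dualisable_eq`).
HONEST LABEL.  Count-neutral (`--supports`); nothing printed is asserted; (MS) stays a PROVER TARGET (empirical census law); `HC_CM` is proved only modulo the 7 printed citations
(2 remaining named inputs: hLiu418 = `stmt-HodgeConjecture-24832`, h413 = `stmt-HodgeConjecture-24833`) until rung 0 closes.

## References
* [Kottwitz1986BaseChangeUnits] R. E. Kottwitz, *Base change for unit elements of Hecke algebras*, Compositio Math. 60 (1986), §1 pp. 240–241 (orbital integrals of units as
  lattice counts modulo the torus).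
* [Rogawski1990] J. D. Rogawski, *Automorphic Representations of Unitary Groups in Three Variables*, Ann. of Math. Stud. 123 (1990), §4.9 Prop. 4.9.1 (a) p. 55.
* [Serre1980Trees] J.-P. Serre, *Trees*, Springer (1980), Ch. II §1.1.
-/

set_option autoImplicit false

noncomputable section

namespace Summit.HodgeConjecture.HodgeConjecture.Cruxes.H413.F0P3cDyRamDiagonalOrbitCount

open Matrix
open Literature.NumberTheory.Automorphic Literature.NumberTheory.Automorphic.HermitianLattice
open Literature.NumberTheory.Automorphic.UnitaryLatticeTree
open Summit.HodgeConjecture.HodgeConjecture.Cruxes.H413.F0P3cDyRamDiagonalTorusDefs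
open Summit.HodgeConjecture.HodgeConjecture.Cruxes.H413.F0P3cDyRamDiagonalOrbitFibreCountHeads
open Summit.HodgeConjecture.HodgeConjecture.Cruxes.H413.F0P3cDyRamDiagonalOrbitAveraging
open scoped Valued WithZero Matrix MatrixGroups

variable {K : Type*} [Field K] [Valued K ℤᵐ⁰]

/-- **(O2c) THE ORBIT COUNT — STAGE A OF (MS), ANY VERTEX TYPE `tv`, UNDER THE ONE-COSET HYPOTHESIS `hcoset` (LH4-p10 (g2) B9-0 VERBATIM, at every `M₀ ∈ 𝓛₀(T)`).**
For `T = diag(s)` (`s` pairwise-distinct units), an involution `σ` with `v ∘ σ = v`, a uniformiser `ϖ = ↑ϖu`, and a `σ`-fixed NON-NORM unit `c` with the index-two dichotomy: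
`↑(Σ_{e : Fin 3 → Bool} #{M : M type-tv for diag(c^{e}), T·M = M}) = 8 · Σᶠ_{M₀ ∈ {M ∈ 𝓛₀(T) | ∃ D σ-fixed non-degenerate, M type-tv for diag D}} stabiliserWeight σ M₀` over `ℚ` —
(O2c) FILE 1 §4 `…_of_fibre_identity` fed with ★ (O2b) PART 4 `finsum_ncard_fibre_mul_relIndex_eq_of_mem_normalisedStableLattices`.  The right-hand set is the B10₂ (type-2 twin)
input currency. [cite: Kottwitz1986BaseChangeUnits, §1 pp. 240–241] [cite: Rogawski1990, §4.9 Prop. 4.9.1 (a) p. 55] -/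
theorem sum_ncard_fixed_vertices_eq_eight_mul_finsum_stabiliserWeight [Finite 𝓀[K]] {σ : K →+* K} (hσ : ∀ x, σ (σ x) = x)
    (hvσ : ∀ a, Valued.v (σ a) = Valued.v a) {ϖ : K} (hϖ : Valued.v ϖ = WithZero.exp (-1 : ℤ)) (ϖu : Kˣ) (hϖu : (ϖu : K) = ϖ)
    {c : K} (hσc : σ c = c) (hcv : Valued.v c = 1) (hc : ¬ ∃ z : K, z * σ z = c)
    (hdich : ∀ x : K, σ x = x → x ≠ 0 → (∃ z : K, z * σ z = x) ∨ ∃ z : K, z * σ z = c * x)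
    {s : Fin 3 → K} (hs : ∀ i, Valued.v (s i) = 1) (hreg : ∀ i j, i ≠ j → s i ≠ s j)
    (T : GL (Fin 3) K) (hT : (T : Matrix (Fin 3) (Fin 3) K) = Matrix.diagonal s) (tv : ℕ)
    (hcoset : ∀ M₀ ∈ normalisedStableLattices T, ∀ D₁ : Fin 3 → K, (∀ i, σ (D₁ i) = D₁ i ∧ D₁ i ≠ 0) →
      IsVertexLattice σ ϖ (Matrix.diagonal D₁) tv M₀ → ∀ D : Fin 3 → K, (∀ i, σ (D i) = D i ∧ D i ≠ 0) →
        (IsVertexLattice σ ϖ (Matrix.diagonal D) tv M₀ ↔ ∃ u ∈ fixedUnitStabilizer σ M₀, ∀ i, D i = D₁ i * (u i : Kˣ))) :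
    (((∑ e : Fin 3 → Bool, {M : Submodule 𝒪[K] (Fin 3 → K) |
        IsVertexLattice σ ϖ (Matrix.diagonal fun i => if e i then c else (1 : K)) tv M ∧ mapGL T M = M}.ncard : ℕ) : ℚ)) =
      8 * ∑ᶠ M₀ ∈ {M : Submodule 𝒪[K] (Fin 3 → K) | M ∈ normalisedStableLattices T ∧
        ∃ D : Fin 3 → K, (∀ i, σ (D i) = D i ∧ D i ≠ 0) ∧ IsVertexLattice σ ϖ (Matrix.diagonal D) tv M}, stabiliserWeight σ M₀ :=
  sum_ncard_fixed_vertices_eq_eight_mul_finsum_stabiliserWeight_of_fibre_identity hvσ hϖ ϖu hϖu hcv hs hreg T hT tv _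
    fun M₀ hM₀ => finsum_ncard_fibre_mul_relIndex_eq_of_mem_normalisedStableLattices hσ hvσ hϖ ϖu hϖu hσc hcv hc hdich hs hreg T hT hM₀ tv
      (hcoset M₀ hM₀)

/-- **(O2c) THE ORBIT COUNT AT TYPE 0, UNCONDITIONALLY — STAGE A OF (MS) IN THE B10 INPUT CURRENCY.**  Same data, `tv = 0` (the one-coset property is ★ (O2b) PART 2
`fibre_isCoset_zero`, so no `hcoset`): `↑(Σ_{e : Fin 3 → Bool} #{M : M type-0 for diag(c^{e}), T·M = M}) = 8 · Σᶠ_{M₀ ∈ {M ∈ 𝓛₀(T) | IsDualisableLattice σ ϖ M}} stabiliserWeight σ M₀`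
over `ℚ` — the left-hand side is the `tv = 0` summand block of MS :109 token for token, the right-hand finsum is the left-hand side of B10 `finsum_stabiliserWeight_dualisable_eq`
VERBATIM. [cite: Kottwitz1986BaseChangeUnits, §1 pp. 240–241] [cite: Rogawski1990, §4.9 Prop. 4.9.1 (a) p. 55] -/
theorem sum_ncard_fixed_vertices_eq_eight_mul_finsum_stabiliserWeight_zero [Finite 𝓀[K]] {σ : K →+* K} (hσ : ∀ x, σ (σ x) = x)
    (hvσ : ∀ a, Valued.v (σ a) = Valued.v a) {ϖ : K} (hϖ : Valued.v ϖ = WithZero.exp (-1 : ℤ)) (ϖu : Kˣ) (hϖu : (ϖu : K) = ϖ)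
    {c : K} (hσc : σ c = c) (hcv : Valued.v c = 1) (hc : ¬ ∃ z : K, z * σ z = c)
    (hdich : ∀ x : K, σ x = x → x ≠ 0 → (∃ z : K, z * σ z = x) ∨ ∃ z : K, z * σ z = c * x)
    {s : Fin 3 → K} (hs : ∀ i, Valued.v (s i) = 1) (hreg : ∀ i j, i ≠ j → s i ≠ s j)
    (T : GL (Fin 3) K) (hT : (T : Matrix (Fin 3) (Fin 3) K) = Matrix.diagonal s) :
    (((∑ e : Fin 3 → Bool, {M : Submodule 𝒪[K] (Fin 3 → K) |
        IsVertexLattice σ ϖ (Matrix.diagonal fun i => if e i then c else (1 : K)) 0 M ∧ mapGL T M = M}.ncard : ℕ) : ℚ)) =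
      8 * ∑ᶠ M₀ ∈ {M : Submodule 𝒪[K] (Fin 3 → K) | M ∈ normalisedStableLattices T ∧ IsDualisableLattice σ ϖ M}, stabiliserWeight σ M₀ :=
  sum_ncard_fixed_vertices_eq_eight_mul_finsum_stabiliserWeight_of_fibre_identity hvσ hϖ ϖu hϖu hcv hs hreg T hT 0 (IsDualisableLattice σ ϖ)
    fun _ hM₀ => finsum_ncard_fibre_mul_relIndex_eq_of_mem_normalisedStableLattices_zero hσ hvσ hϖ ϖu hϖu hσc hcv hc hdich hs hreg T hT hM₀

/-! ## ED. 2 (append-only; LH4-p11 (g2) RULING 2026-09-04T00:53Z «RE-KEY tv = 2 ON MULTIPLICITY», LH4-p10 (g2) ratified 00:58:37Z, heir LEAD (R-21)): the (O2c) head WITH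
MULTIPLICITY — Stage A of (MS) at any vertex type, no one-coset hypothesis: the count `polarisationCount σ ϖ tv M₀ = #(Δ_tv(M₀)∕S_F(M₀))` (★ StrataDefs ED. 3) replaces the Iverson bracket.
(On the glued type-2 strata with `ρ` even it is `q`, not `1` — LH4-p09 (g2) 2026-09-04T00:42:58Z; the `hcoset` head above is therefore not dischargeable at `tv = 2` and stays
only as the one-coset special case.) -/

open Summit.HodgeConjecture.HodgeConjecture.Cruxes.H413.F0P3cDyRamDiagonalStrataDefs in
/-- **(O2c) WITH MULTIPLICITY — STAGE A OF (MS), ANY VERTEX TYPE, UNCONDITIONAL.**  For `T = diag(s)` (`s` pairwise-distinct units, finite residue field), an involution `σ` with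
`v ∘ σ = v`, a uniformiser `ϖ = ↑ϖu`, and a `σ`-fixed non-norm unit `c` with the index-two dichotomy:
`↑(Σ_{e : Fin 3 → Bool} #{M : M type-tv for diag(c^{e}), T·M = M}) = 8 · Σᶠ_{M₀ ∈ 𝓛₀(T)} polarisationCount σ ϖ tv M₀ · stabiliserWeight σ M₀` over `ℚ` — ★ OrbitAveraging ED. 2 §6
`sum_ncard_fixed_vertices_eq_eight_mul_finsum_mul_stabiliserWeight_of_fibre_identity` at `m := polarisationCount σ ϖ tv`, fed with ★ (O2b)-MULT M3
`finsum_ncard_fibre_mul_relIndex_eq_mul_ncard_cosets_of_mem_normalisedStableLattices` (LH4-p14 (g2); its last factor is `polarisationCosets σ ϖ tv M₀` written out, so the count is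
`polarisationCount` by `rfl`).  At `tv = 2` this is the `hA₂` binder of ★ `F0P3cDyRamStableModelSumOfStageB.stableModelSum_of_stageB_mult`; at `tv = 0` it agrees with `…_zero`
above (`polarisationCount σ ϖ 0 = 1` on the dualisable normalised lattices, ★ `fibre_isCoset_zero`). [cite: Kottwitz1986BaseChangeUnits, §1 pp. 240–241] [cite: Rogawski1990, §4.9 Prop. 4.9.1 (a) p. 55] -/
theorem sum_ncard_fixed_vertices_eq_eight_mul_finsum_polarisationCount_mul_stabiliserWeight [Finite 𝓀[K]] {σ : K →+* K} (hσ : ∀ x, σ (σ x) = x)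
    (hvσ : ∀ a, Valued.v (σ a) = Valued.v a) {ϖ : K} (hϖ : Valued.v ϖ = WithZero.exp (-1 : ℤ)) (ϖu : Kˣ) (hϖu : (ϖu : K) = ϖ)
    {c : K} (hσc : σ c = c) (hcv : Valued.v c = 1) (hc : ¬ ∃ z : K, z * σ z = c)
    (hdich : ∀ x : K, σ x = x → x ≠ 0 → (∃ z : K, z * σ z = x) ∨ ∃ z : K, z * σ z = c * x)
    {s : Fin 3 → K} (hs : ∀ i, Valued.v (s i) = 1) (hreg : ∀ i j, i ≠ j → s i ≠ s j)
    (T : GL (Fin 3) K) (hT : (T : Matrix (Fin 3) (Fin 3) K) = Matrix.diagonal s) (tv : ℕ) :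
    (((∑ e : Fin 3 → Bool, {M : Submodule 𝒪[K] (Fin 3 → K) |
        IsVertexLattice σ ϖ (Matrix.diagonal fun i => if e i then c else (1 : K)) tv M ∧ mapGL T M = M}.ncard : ℕ) : ℚ)) =
      8 * ∑ᶠ M₀ ∈ normalisedStableLattices T, (polarisationCount σ ϖ tv M₀ : ℚ) * stabiliserWeight σ M₀ :=
  sum_ncard_fixed_vertices_eq_eight_mul_finsum_mul_stabiliserWeight_of_fibre_identity hvσ hϖ ϖu hϖu hcv hs hreg T hT tv (polarisationCount σ ϖ tv)
    fun _ hM₀ => F0P3cDyRamDiagonalOrbitFibreCountMultHeads.finsum_ncard_fibre_mul_relIndex_eq_mul_ncard_cosets_of_mem_normalisedStableLattices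
      hσ hvσ hϖ ϖu hϖu hσc hcv hc hdich hs hreg T hT hM₀ tv

end Summit.HodgeConjecture.HodgeConjecture.Cruxes.H413.F0P3cDyRamDiagonalOrbitCount

end
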